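import Mathlib
import HarnessLib
import Summits.ValiantsHypothesis.ValiantsHypothesis.Theses.MonotoneRestoration
import Literature.Computability.AlgebraicComplexity.SupportSymmetrisationEval
import Summits.ValiantsHypothesis.ValiantsHypothesis.Theorems.MonotoneRestorationMonotoneRestorationQPVariants20112
import Summits.ValiantsHypothesis.ValiantsHypothesis.Theorems.MonotoneRestorationMonotoneRestorationQPBeta
import Summits.ValiantsHypothesis.ValiantsHypothesis.Theorems.MonotoneRestorationMultilinearRestorationQPValues
import Summits.ValiantsHypothesis.ValiantsHypothesis.Theorems.MonotoneRestorationMonotoneRestorationQPVariants20153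
import Literature.Computability.AlgebraicComplexity.QPBoundedClosure

/-!
# The multilinear rung in S5 currency (variant V20114 of `stub_monotoneSupportReduction`):
reduction to the core and comparison with `MultilinearRestorationQP`

Helper file (`--supports stmt-ValiantsHypothesis-17621`, the rung `MultilinearRestorationQP`; it equally
serves the crux item stmt-ValiantsHypothesis-15886), written by the TTRL-lite deep seat of
variant V20114 ("poly-size syntactically multilinear monotone circuits for a matrix-symmetric
family over `ℝ≥0` ⇒ quasi-polynomial support programs of polylog width" — the route's open rung
`MultilinearRestorationQP`, stmt-ValiantsHypothesis-17621, in the support-program currency of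
`stub_monotoneSupportReduction`).  The variant is open; this file records its exact position:

* `stub_monotoneSupportReduction_var20114_of_core` — V20114 follows from its restriction to the
  CORE class: families whose total degree exceeds every polylog level `(log₂ n + c)^c` at some
  `n` where, moreover, some monomial uses a row or a column twice.  The complement is the
  polylog-degree slice, landed as the sibling variant `stub_monotoneSupportReduction_var20112`
  (sparse monomial program); at an `n` of superpolylog degree the family cannot be
  bi-multilinear, by Theorem β's count `biMultilinear_two_pow_totalDegree_le`
  (`2^deg ≤ 64 (L⁺ + 1)³ (deg + 1)⁶`, with `L⁺ ≤ smCircuitSize`) and `stub_betaArithmetic`.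
* `multilinearRestorationQP_of_var20114` — V20114 implies the open rung
  `MultilinearRestorationQP` (coset-block symmetrisation
  `SupportSymm.exists_symmetric_circuit_of_supports` + the arithmetic of variant V20153), so it
  is at least as hard as stmt-ValiantsHypothesis-17621.

Sources: Jerrum–Snir 1982 §4.3 (via Theorem β), Dawar–Pago–Seppelt 2025 §5 (symmetrisation);
`IsQPBounded.qexp_mono` from `Literature/Computability/AlgebraicComplexity/QPBoundedClosure.lean`.
No named facts, no defs.
-/

set_option linter.dupNamespace false

namespace Summit.ValiantsHypothesis.ValiantsHypothesis.Theorems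

open Summit.ValiantsHypothesis.ValiantsHypothesis.Theses.MonotoneRestoration
open Literature.Computability.AlgebraicComplexity

/-! ### V20114 reduces to its superpolylog-degree, row/column-reusing core -/

/-- **Deep-seat decomposition of V20114.** The multilinear rung in support-program currency
follows from its restriction to families whose degree exceeds every polylog level infinitely
often AND which reuse a row or a column at such `n` (the complement is the polylog-degree slice
`supportProgram_of_polylogDegree`; Theorem β's count `biMultilinear_two_pow_totalDegree_le`
shows that at an `n` of superpolylog degree the family cannot be bi-multilinear). -/
theorem stub_monotoneSupportReduction_var20114_of_core
    (hcore : ∀ f : (n : ℕ) → MvPolynomial (Fin n × Fin n) NNReal,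
      (∀ (n : ℕ) (σ τ : Equiv.Perm (Fin n)),
        MvPolynomial.rename (fun p : Fin n × Fin n => (σ p.1, τ p.2)) (f n) = f n) →
      (∃ c : ℕ, ∀ n : ℕ, smCircuitSize (k := NNReal) (f n) ≤ ((n + 2) ^ c : ℕ)) →
      (∀ c : ℕ, ∃ n : ℕ, (Nat.log 2 n + c) ^ c < (f n).totalDegree ∧
        ∃ m ∈ (f n).support, ∃ i : Fin n, 2 ≤ rowCount m i ∨ 2 ≤ colCount m i) →
      ∃ c : ℕ, ∀ n : ℕ, ∃ (P : ArithCircuit ℂ (Fin n × Fin n)) (K : ℕ → Finset (Fin n)),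
        (∀ g ∈ P.gates, g.args ≠ []) ∧
        (∀ g ∈ P.gates, g.fanIn ≤ 2 ^ ((Nat.log 2 n + c) ^ c)) ∧ P.WellFormed ∧
        (∀ i, (K i).card ≤ (Nat.log 2 n + c) ^ c) ∧
        (∀ (i : ℕ) (us : List (ArithCircuit.Operand ℂ (Fin n × Fin n))),
          P.gates[i]? = some (ArithCircuit.Gate.prod us) →
            ∀ u ∈ us, SupportSymm.osupp K u ⊆ K i) ∧
        (∀ (i : ℕ) (σ : Equiv.Perm (Fin n)), i < P.size → (∀ x ∈ K i, σ x = x) →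
          MvPolynomial.rename (fun pq : Fin n × Fin n => (σ pq.1, σ pq.2))
            ((ArithCircuit.gateValues P.gates).getD i 0) =
            (ArithCircuit.gateValues P.gates).getD i 0) ∧
        (∃ j, P.output = ArithCircuit.Operand.gate j ∧ j < P.size ∧ K j = ∅) ∧
        P.size ≤ 2 ^ ((Nat.log 2 n + c) ^ c) ∧
        P.eval = MvPolynomial.map (Complex.ofRealHom.comp NNReal.toRealHom) (f n)) :
    ∀ f : (n : ℕ) → MvPolynomial (Fin n × Fin n) NNReal,
      (∀ (n : ℕ) (σ τ : Equiv.Perm (Fin n)),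
        MvPolynomial.rename (fun p : Fin n × Fin n => (σ p.1, τ p.2)) (f n) = f n) →
      (∃ c : ℕ, ∀ n : ℕ, smCircuitSize (k := NNReal) (f n) ≤ ((n + 2) ^ c : ℕ)) →
      ∃ c : ℕ, ∀ n : ℕ, ∃ (P : ArithCircuit ℂ (Fin n × Fin n)) (K : ℕ → Finset (Fin n)),
        (∀ g ∈ P.gates, g.args ≠ []) ∧
        (∀ g ∈ P.gates, g.fanIn ≤ 2 ^ ((Nat.log 2 n + c) ^ c)) ∧ P.WellFormed ∧
        (∀ i, (K i).card ≤ (Nat.log 2 n + c) ^ c) ∧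
        (∀ (i : ℕ) (us : List (ArithCircuit.Operand ℂ (Fin n × Fin n))),
          P.gates[i]? = some (ArithCircuit.Gate.prod us) →
            ∀ u ∈ us, SupportSymm.osupp K u ⊆ K i) ∧
        (∀ (i : ℕ) (σ : Equiv.Perm (Fin n)), i < P.size → (∀ x ∈ K i, σ x = x) →
          MvPolynomial.rename (fun pq : Fin n × Fin n => (σ pq.1, σ pq.2))
            ((ArithCircuit.gateValues P.gates).getD i 0) =
            (ArithCircuit.gateValues P.gates).getD i 0) ∧
        (∃ j, P.output = ArithCircuit.Operand.gate j ∧ j < P.size ∧ K j = ∅) ∧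
        P.size ≤ 2 ^ ((Nat.log 2 n + c) ^ c) ∧
        P.eval = MvPolynomial.map (Complex.ofRealHom.comp NNReal.toRealHom) (f n) := by
  intro f hsym hsm
  by_cases hdeg : ∃ c : ℕ, ∀ n : ℕ, (f n).totalDegree ≤ (Nat.log 2 n + c) ^ c
  · exact stub_monotoneSupportReduction_var20112 f hsym hdeg
  · refine hcore f hsym hsm fun c => ?_
    obtain ⟨c₀, hc₀⟩ := hsm
    obtain ⟨cβ, hcβ⟩ := stub_betaArithmetic (max c₀ 2)
    push Not at hdeg
    obtain ⟨n, hn⟩ := hdeg (max c cβ)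
    refine ⟨n, lt_of_le_of_lt (IsQPBounded.qexp_mono _ (le_max_left c cβ)) hn, ?_⟩
    by_contra hbi
    push Not at hbi
    have hbi' : ∀ m ∈ (f n).support, (∀ i, rowCount m i ≤ 1) ∧ (∀ j, colCount m j ≤ 1) :=
      fun m hm => ⟨fun i => Nat.lt_succ_iff.mp (hbi m hm i).1,
        fun j => Nat.lt_succ_iff.mp (hbi m hm j).2⟩
    have h2 := biMultilinear_two_pow_totalDegree_le (f n) (hsym n) hbi'
    have hbase : 1 ≤ n + 2 := by omega
    have hs : complexity (f n) ≤ (n + 2) ^ max c₀ 2 :=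
      (MultilinearRung.complexity_le_of_smCircuitSize_le (hc₀ n)).trans
        (Nat.pow_le_pow_right hbase (le_max_left _ _))
    have hk : (f n).totalDegree ≤ (n + 2) ^ max c₀ 2 := by
      calc (f n).totalDegree ≤ Fintype.card (Fin n × Fin n) :=
            MultilinearRung.totalDegree_le_of_smCircuitSize_le (hc₀ n)
        _ = n * n := by simp
        _ ≤ (n + 2) ^ 2 := by nlinarith
        _ ≤ (n + 2) ^ max c₀ 2 := Nat.pow_le_pow_right hbase (le_max_right _ _)
    have hdn : (f n).totalDegree ≤ (Nat.log 2 n + cβ) ^ cβ := hcβ n _ _ hs hk h2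
    exact absurd hn (not_lt.2 (hdn.trans (IsQPBounded.qexp_mono _ (le_max_right c cβ))))

/-! ### V20114 is at least as strong as the open rung `MultilinearRestorationQP` -/

/-- **V20114 implies the route's open rung** `MultilinearRestorationQP`
(stmt-ValiantsHypothesis-17621): a support program of quasi-polynomial size / fan-in and polylog
width is turned into a square-symmetric `LabelledArithCircuit` of quasi-polynomial size by the
coset-block symmetrisation `SupportSymm.exists_symmetric_circuit_of_supports`
(Dawar–Pago–Seppelt 2025 §5) and the arithmetic of the sibling variant V20153. So a proof of
V20114 would close the open rung. [cite: DawarPagoSeppelt2025, §5] -/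
theorem multilinearRestorationQP_of_var20114
    (h : ∀ f : (n : ℕ) → MvPolynomial (Fin n × Fin n) NNReal,
      (∀ (n : ℕ) (σ τ : Equiv.Perm (Fin n)),
        MvPolynomial.rename (fun p : Fin n × Fin n => (σ p.1, τ p.2)) (f n) = f n) →
      (∃ c : ℕ, ∀ n : ℕ, smCircuitSize (k := NNReal) (f n) ≤ ((n + 2) ^ c : ℕ)) →
      ∃ c : ℕ, ∀ n : ℕ, ∃ (P : ArithCircuit ℂ (Fin n × Fin n)) (K : ℕ → Finset (Fin n)),
        (∀ g ∈ P.gates, g.args ≠ []) ∧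
        (∀ g ∈ P.gates, g.fanIn ≤ 2 ^ ((Nat.log 2 n + c) ^ c)) ∧ P.WellFormed ∧
        (∀ i, (K i).card ≤ (Nat.log 2 n + c) ^ c) ∧
        (∀ (i : ℕ) (us : List (ArithCircuit.Operand ℂ (Fin n × Fin n))),
          P.gates[i]? = some (ArithCircuit.Gate.prod us) →
            ∀ u ∈ us, SupportSymm.osupp K u ⊆ K i) ∧
        (∀ (i : ℕ) (σ : Equiv.Perm (Fin n)), i < P.size → (∀ x ∈ K i, σ x = x) →
          MvPolynomial.rename (fun pq : Fin n × Fin n => (σ pq.1, σ pq.2))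
            ((ArithCircuit.gateValues P.gates).getD i 0) =
            (ArithCircuit.gateValues P.gates).getD i 0) ∧
        (∃ j, P.output = ArithCircuit.Operand.gate j ∧ j < P.size ∧ K j = ∅) ∧
        P.size ≤ 2 ^ ((Nat.log 2 n + c) ^ c) ∧
        P.eval = MvPolynomial.map (Complex.ofRealHom.comp NNReal.toRealHom) (f n)) :
    MultilinearRestorationQP := by
  intro f hsym hsm
  obtain ⟨c, hc⟩ := h f hsym hsm
  obtain ⟨c', hc'⟩ := stub_monotoneSupportReduction_var20153 c
  refine ⟨c', fun n => ?_⟩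
  obtain ⟨P, K, hne, hfan, hwf, hK, hprod, hinv, hout, hsize, heval⟩ := hc n
  obtain ⟨G, inst, C, hCs, hCe, hCc⟩ :=
    SupportSymm.exists_symmetric_circuit_of_supports ((Nat.log 2 n + c) ^ c)
      (2 ^ ((Nat.log 2 n + c) ^ c)) P K hne hfan hwf hK hprod hinv hout
  refine ⟨G, inst, C, hCs, hCe.trans heval, hCc.trans (le_trans ?_ (hc' n))⟩
  have h3 : 3 * (P.size + 1) ≤ 3 * (2 ^ ((Nat.log 2 n + c) ^ c) + 1) := by omega
  exact Nat.mul_le_mul_right _ (Nat.mul_le_mul_right _ h3)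

end Summit.ValiantsHypothesis.ValiantsHypothesis.Theorems
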